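import Summits.BirchSwinnertonDyer.Rank1Residual.Additive.TwistedBranchPAdicGrossZagier
import Summits.BirchSwinnertonDyer.Rank1Residual.Additive.BranchPAdicGrossZagierIff
import Summits.BirchSwinnertonDyer.Rank1Residual.Additive.X3GordBranchPAdicGrossZagierIff
import Summits.BirchSwinnertonDyer.Rank1Residual.Additive.X3BranchMainConjectureGordOfFacts
import Summits.BirchSwinnertonDyer.Rank1Residual.Additive.N10TwistClauseBSTW121c
import Summits.BirchSwinnertonDyer.Rank1Residual.Additive.GordRankOneKatoUpperBound
import Summits.BirchSwinnertonDyer.Rank1Residual.X2.GreenbergVatsalCaseOne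
import HarnessLib

/-!
# Row B6 (O7-ord), defect 2, RANK ONE, CLASS FORM: the named fact `delbourgoDatum_rankOne_leadingTerms`
# (PROOF-gz Thm. 1 for Delbourgo's datum) closes the tree's rank-one branch loop — `BSD(E,p)` on
# X3♯(G-ord, `e = 2`) from PUBLISHED facts + the fact + the line datum + one analytic non-vanishing,
# and on X4♯(G-ord, `e = 2`) modulo the BSTW twist clause (the "O7 twin" of the cell planner)
# (cell `bsd-addord`, FULL-BSD rank-≤ 1 programme D-0033 tranche 1a, seat `bsd-addord-gz`, session 3;
# TARGET.md v2 §8 "O7 twin" / L1.18 hook, R-O7 (2), R-O7″ (3); third file after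
# `TwistedBranchPAdicGrossZagier{,BSD}.lean`)

HONEST FRAMING. Theorems only: no definition, no named fact minted here, no `sorry`, nothing booked,
no label of the residual map changed. The tree (cell `b2b-bsdres`, T-O7c) proved that on the
semistable-twist rows of O7-ord in analytic rank one `BSD(E,p)` follows from THREE inputs: (L) the
Λ-adic branch LOWER containment `ChiBranchLowerDivisibility{,Odd}At W p`, (GZ) the typed branch
`p`-adic Gross–Zagier `BranchPAdicGrossZagier{,Odd}At W p Dh` for a (B)-datum `Dh`, (S) Schneider's
`Reg_p(E,Dh) ≠ 0` — plus PUBLISHED facts (Delbourgo 2002 (A)+(B), Kato 17.4 / Wuthrich Thm. 16,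
modularity, GZK, Pal 2012 as a tree theorem). This file supplies (GZ) from the cell's named fact
`Disegni2017.delbourgoDatum_rankOne_leadingTerms` (DISPLAYED as `hFact`; its Gross–Zagier half is the
CELL THEOREM PROOF-gz Thm. 1, REF-gz PASS with condition GZ-H; not in print, not asserted), derives
(S) FOR THAT DATUM from the computable analytic certificate `BranchCoeffOneNeZeroAt W p` ("the branch
has a simple zero": `[T¹](ϖ·B) ≠ 0`; by the fact, Schneider ⟺ this), and takes (L): on X3 from the
twist seat's PUBLISHED-only `X3Branch.charIdeal_eq_span_of_facts` (GV (3.12) + Wuthrich 16 + Greenberg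
+ GV §2 + the per-pair line datum `Φ₀`), on X4 from the OPEN/PRE Burungale–Skinner–Tian–Wan twist
clause read Λ-adically (`BurungaleSkinnerTianWan2024_thm921c_twist_chiBranchLowerDivisibility_OPEN`,
the planner's L1.18 hook; NEVER a theorem — a displayed hypothesis).

REFEREE CONDITION GZ-H (binding locator sentence for `hFact`, verbatim in substance): the height
identification behind the fact's Gross–Zagier half (PROOF-gz §3.3, Lemma H) is the
(n-exc)-CONDITIONAL printed sentence Disegni, Compos. Math. 153 (2017) Rem. 1.3.2 (arXiv v3 p. 9)
together with Disegni, Invent. Math. 230 (2022) Thm. B context, with (n-exc) DISCHARGED because `ε_p`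
is ramified (PROOF-gz 3.1 (iv)); it is NOT Delbourgo 2002 p. 62's unconditional sentence, and Nekovář
1993 §7.14 is not held on the hub (acq-10827), so the verification trail is the printed statements of
Disegni 2017/2022. (The (G-ord) rows of this file have `V` GOOD ordinary; the (M) ∩ split-`V` locus the
condition singles out is not touched here.)

## What

* §0 `padicRegulator_ne_zero_of_twisted_identity`, `schneiderConjecture_of_twisted_of_branchCoeffOneNeZero`:
  Schneider for the fact's datum from `[T¹](ϖ·B) ≠ 0` (`log_p γ ≠ 0`; no use of `q ≠ 0`).
* §1 `X3Branch.chiBranchLowerDivisibilityOddAt_of_facts`: the `p ≡ 3 (mod 4)` twin of the twist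
  seat's `X3Branch.chiBranchLowerDivisibilityAt_of_facts` (same proof on the MINUS branch; the
  `W`-level branch main conjecture `X3Branch.charIdeal_eq_span_of_facts` covers both parities).
* §2 **X3♯(G-ord) ∩ `I₀*`, `p ≥ 5`, `r_an = 1`, non-CM, non-anomalous, branch-parity line position,
  BOTH parities of `(p−1)/2`: `BSD(E,p)` from PUBLISHED facts + `hFact` + `BranchCoeffOneNeZeroAt W p`**
  (`ClassX3Gord.bsdp_rankOne_of_facts_of_delbourgoDatumFact_of_branchCoeffOneNeZero{, Odd}`).
* §3 **X4♯(G-ord) ∩ `I₀*` ∩ {`ρ̄` onto} ∩ (ram), `p ≡ 1 (mod 4)`, `r_an = 1`, non-CM, non-anomalous: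
  `BSD(E,p)` from [BSTW twist clause, OPEN] + `hFact` + Kato's half + `BranchCoeffOneNeZeroAt W p`**
  (`ClassX4Gord.bsdp_rankOne_of_BSTW921c_OPEN_of_delbourgoDatumFact_of_katoHalf`) — the "O7 twin".

## What is NOT claimed

No booking (planner's / referee's call); nothing at defect `3,4,6`, on (M) (no Λ-adic LOWER in print
there: residue `hGVM` / K1), at `p ≡ 3 (mod 4)` on X4 (no Λ-adic hook), at `p ∈ {2,3}`, in rank `≠ 1`;
Schneider class-wide (only for the fact's datum, from a per-pair number); BSTW Thm. 9.21(c) is PRE and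
enters ONLY as the displayed hypothesis `hΛ`; the X3 rows need the per-pair line datum `Φ₀` exactly as
the twist seat's rank-zero end state does.

References: [Disegni2017] Thm. A, B, Rem. 1.3.2; [Delbourgo2002] Thm. (A), (B) p. 40, `⟨,⟩_{p,ℚ}` p. 39;
[GreenbergVatsal2000] §2 (11), (16), §3 Thm. (3.12); [GreenbergLNM1716] Props. 2.2, 2.4, 4.14;
[Wuthrich2014] Thm. 16; [Kato2004Asterisque] Thm. 17.4 (3); [Pal2012] Thm. 3.2;
[BurungaleSkinnerTianWan2024] Thm. 9.21(c) (PRE; hypothesis only); [MazurTateTeitelbaum1986Invent]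
§I.13–I.14; [Miller2011LMS] Def. 1.1; cell memo PROOF-gz.md §3, §5, §8; TARGET.md v2 §8, L1.18.
-/

noncomputable section

open scoped Classical MatrixGroups ModularForm NumberField

open CongruenceSubgroup WeierstrassCurve NumberField IsDedekindDomain Field
  Literature.NumberTheory.EllipticCurves Literature.NumberTheory.EllipticCurves.ModularForms
  Literature.NumberTheory.EllipticCurves.GreenbergVatsal2000
  Literature.NumberTheory.EllipticCurves.Rank1Residual
  Literature.NumberTheory.EllipticCurves.Rank1Residual.Typed
  Literature.NumberTheory.EllipticCurves.Delbourgo2002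
  Literature.NumberTheory.EllipticCurves.Disegni2017
  Literature.NumberTheory.GaloisRepresentations
  Summit.BirchSwinnertonDyer.Rank1Residual.AdditivePotMult
  Summit.BirchSwinnertonDyer.Rank1Residual.Additive.X3Branch

namespace Summit.BirchSwinnertonDyer.Rank1Residual.Additive

variable {W : WeierstrassCurve ℚ} [W.IsElliptic] [W.IsGloballyMinimal] {p : ℕ} [hp : Fact p.Prime]

/-! ### §0 Schneider for the fact's datum from the analytic certificate `[T¹](ϖ·B) ≠ 0` -/

/-- Bookkeeping: `x·log_p γ = u·q·R` with `x ≠ 0` and `p ≠ 2` (`log_p γ ≠ 0`) forces `R ≠ 0`.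
[cite: Delbourgo1998, §2.5 BS-D(p) (i), (ii) (pp. 151–152) (shape of the identity)] -/
theorem padicRegulator_ne_zero_of_twisted_identity (hp2 : p ≠ 2) {x R : ℚ_[p]} {u : ℤ_[p]ˣ} {q : ℚ}
    (hx : x ≠ 0)
    (hid : x * padicLog p (cyclotomicGenerator p) = ((u : ℤ_[p]) : ℚ_[p]) * (q : ℚ_[p]) * R) :
    R ≠ 0 := by
  obtain ⟨hℓ0, -⟩ := X2.valuation_padicLog_cyclotomicGenerator (p := p) hp2
  intro hR
  rw [hR, mul_zero] at hid
  exact mul_ne_zero hx hℓ0 hid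

/-- **Schneider for the fact's datum from one analytic number.** For `W` of analytic rank one with
`L(E,s)` entire, a datum `Dh` carrying the twisted-branch Gross–Zagier clauses
(`TwistedBranchGrossZagierAt W p Dh`), and a good ORDINARY twist model `C • V^{(p*)} = W`: if the
Néron-normalised branch of `V` has a SIMPLE zero (`BranchCoeffOneNeZeroAt W p`, the census's `A′ ≠ 0`),
then `Reg_p(E,Dh) ≠ 0` — `ϖ·[T¹]B·log_p γ = u·q·Reg_p(E,Dh)` with `ϖ·[T¹]B ≠ 0`, `log_p γ ≠ 0`. For
Delbourgo's `⟨,⟩_{p,ℚ}` this is Schneider's conjecture at the pair (PROOF-gz Cor. 3).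
[cite: Delbourgo1998, §2.5 BS-D(p) (i), (ii) (pp. 151–152)] [cite: MazurTateTeitelbaum1986Invent, §I.13–I.14] -/
theorem schneiderConjecture_of_twisted_of_branchCoeffOneNeZero (hp2 : p ≠ 2)
    (hmodD : nonempty_modularParametrizationData)
    (hr : W.analyticRank = 1) {Dh : PAdicHeightData W p} (hTw : TwistedBranchGrossZagierAt W p Dh)
    (hne : BranchCoeffOneNeZeroAt W p) (V : WeierstrassCurve ℚ) [V.IsElliptic] [V.IsGloballyMinimal]
    (C : VariableChange ℚ) (hC : C • V.quadraticTwist ((-1 : ℚ) ^ (p / 2) * p) = W)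
    (hord : IsOrdinaryAt V p) : SchneiderConjecture Dh := by
  have hodd : p % 4 = 1 ∨ p % 4 = 3 := by
    obtain ⟨k, hk⟩ := hp.out.odd_of_ne_two hp2
    omega
  haveI : NeZero (V.conductorNorm ℤ) := ⟨(V.conductorNorm_pos_holds).ne'⟩
  obtain ⟨Dm⟩ := hmodD V
  obtain ⟨ϖ, hϖ⟩ := exists_periodRatio_parity (p := p) V Dm
  have h1 := hne V C hC hord Dm.f Dm.isNewformOf ϖ hϖ
  obtain ⟨q, -, heven, hoddc⟩ := hTw hr V Dm.f (Or.inl hord.1) Dm.isNewformOf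
  rw [SchneiderConjecture]
  rcases hodd with h1' | h3
  · have hev : Even (p / 2) := ⟨p / 4, by omega⟩
    rw [if_pos hev] at hϖ h1
    have hC' : C • V.quadraticTwist (p : ℚ) = W := by
      rw [pStar_eq_of_mod_four p (Or.inl h1'), if_pos h1'] at hC
      exact hC
    obtain ⟨u, hu⟩ := (heven C ϖ h1' hC' hϖ).1 hord
    rw [PowerSeries.coeff_C_mul] at h1
    exact padicRegulator_ne_zero_of_twisted_identity hp2 h1 hu
  · have hne' : ¬ Even (p / 2) := by
      rw [Nat.not_even_iff_odd]
      exact ⟨p / 4, by omega⟩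
    rw [if_neg hne'] at hϖ h1
    have hC' : C • V.quadraticTwist (-(p : ℚ)) = W := by
      rw [pStar_eq_of_mod_four p (Or.inr h3), if_neg (by omega)] at hC
      exact hC
    obtain ⟨u, hu⟩ := (hoddc C ϖ h3 hC' hϖ).1 hord
    rw [PowerSeries.coeff_C_mul] at h1
    exact padicRegulator_ne_zero_of_twisted_identity hp2 h1 hu

/-! ### §1 X3, `p ≡ 3 (mod 4)`: the Λ-adic ODD containment from PUBLISHED facts + the line data -/

/-- **`p ≡ 3 (mod 4)`: `ChiBranchLowerDivisibilityOddAt W p` FROM PUBLISHED FACTS** + the line data —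
the MINUS-branch twin of the twist seat's `X3Branch.chiBranchLowerDivisibilityAt_of_facts`, read off the
both-parity `W`-level branch main conjecture `X3Branch.charIdeal_eq_span_of_facts` (`char_Λ X(W/ℚ_∞) =
(g')`, `ι g' = u·ϖ·L⁻_p(f_V, α_V, ω^{(p−1)/2}, T)`): every `g ∈ char_Λ X` is `ι(h)·(ϖ·L⁻_p)`.
[cite: GreenbergVatsal2000, §3 Thm. (3.12) p. 45] [cite: Wuthrich2014, Thm. 16 (p. 397)]
[cite: GreenbergLNM1716, Props. 2.2, 2.4, 4.14] [cite: SkinnerUrban2014, Thm. 3.6.4 (p. 43) (shape only)] -/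
theorem X3Branch.chiBranchLowerDivisibilityOddAt_of_facts
    (hW16 : Wuthrich2014.thm16_halfEigenCharIdeal_dvd_cyclotomicPrime)
    (hGV : thm312_branch_unitContent_and_lambda_eq_residual_goodOrd)
    (h23 : datumSelmer_nonPrimitive_invariants)
    (h414 : Greenberg1999.prop414_noFiniteSubmodule_of_not_dvd_torsionOrder)
    (hGrK : Greenberg1999.imKummer_ge_strictCondition_goodOrdinary)
    (hLiftF : residualEpsilon_surjOn_of_lineRamifiedEven)
    (S₀ : Finset (HeightOneSpectrum (𝓞 ℚ))) (hS₀ : ∀ v ∈ S₀, ((p : ℕ) : 𝓞 ℚ) ∉ v.asIdeal)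
    (hS : ∀ v : HeightOneSpectrum (𝓞 ℚ), v ∉ S₀ → ((p : ℕ) : 𝓞 ℚ) ∉ v.asIdeal →
      W.HasGoodReductionAt v)
    (Φ₀ : AddSubgroup (W.geomTorsion (p : ℤ))) (hΦ : IsRationalLine W p Φ₀)
    (hram0 : ¬ LineUnramifiedAt W p Φ₀) (heven : LineEven W p Φ₀)
    (hram : ∀ (K : Type) [Field K] [NumberField K] [(galRange (K := ℚ) K).Normal],
      Module.finrank ℚ K = 2 → (∃ θ : K, θ ^ 2 = algebraMap ℚ K ((-1) ^ (p / 2) * p)) →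
      ¬ ∀ v : HeightOneSpectrum (𝓞 ℚ), ((p : ℕ) : 𝓞 ℚ) ∈ v.asIdeal →
        ∀ 𝔓 ∈ v.primesAbove, ∀ σ ∈ 𝔓.inertia (absoluteGaloisGroup ℚ), ∀ P ∈ Φ₀,
          σ • P = (if σ ∈ galRange (K := ℚ) K then P else -P)) :
    ChiBranchLowerDivisibilityOddAt W p := by
  intro V _ _ κ γ N _ f hp3 hCW hgood hκ hγ hcv hf D ϖ hϖ g hg
  have hp2 : p ≠ 2 := by omega
  have hodd' : ¬ Even (p / 2) := by
    rw [Nat.not_even_iff_odd]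
    exact ⟨p / 4, by omega⟩
  have hps : ((-1 : ℚ) ^ (p / 2) * (p : ℚ)) = -(p : ℚ) := by
    rw [pStar_eq_of_mod_four p (Or.inr hp3), if_neg (by omega)]
  obtain ⟨C, hC⟩ := hCW
  have hC' : C • V.quadraticTwist ((-1) ^ (p / 2) * p : ℚ) = W := by rw [hps]; exact hC
  obtain ⟨-, g', hchar, u, hι⟩ := X3Branch.charIdeal_eq_span_of_facts hW16 hGV h23 h414 hGrK hLiftF
    hp2 hgood hC' S₀ hS₀ hS Φ₀ hΦ hram0 heven hram hκ hγ hcv hf D ϖ (by rw [if_neg hodd']; exact hϖ)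
  rw [if_neg hodd'] at hι
  have hg' : g ∈ Ideal.span ({g'} : Set (IwasawaAlgebra p)) := by rw [← hchar]; exact hg
  obtain ⟨a, rfl⟩ := Ideal.mem_span_singleton'.mp hg'
  refine ⟨PowerSeries.C (u : ℤ_[p]) * a, ?_⟩
  have hCu : PowerSeries.C ((((u : ℤ_[p]) : ℚ_[p])) * (ϖ : ℚ_[p])) =
      PowerSeries.C (((u : ℤ_[p]) : ℚ_[p])) * PowerSeries.C (ϖ : ℚ_[p]) := map_mul _ _ _
  rw [map_mul, hι, iwasawaToPowerSeries_C_mul', hCu]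
  ring

/-! ### §2 X3♯(G-ord) ∩ `I₀*`, rank one: `BSD(E,p)` from PUBLISHED facts + the fact + one number -/

/-- **X3♯(G-ord) ∩ `I₀*` (`E[p]` reducible, `e = 2`), `p ≡ 1 (mod 4)`, `E` non-CM, `r_an(E) = 1`,
non-anomalous, branch-parity line position: `BSD(E,p)` from PUBLISHED named facts + the cell's fact
`hFact` + ONE analytic number (`BranchCoeffOneNeZeroAt W p`).** Published binders: Wuthrich 2014
Thm. 16 (`hW16`), GV 2000 Thm. (3.12)/§2 (`hGV`, `h23`, `hLiftF`), Greenberg 1999 (`h414`, `hGrK`),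
Delbourgo 2002 (A)+(B) (`hDel`), modularity (`hmod`, `hmodD`), GZK (`hGZK`); Pal 2012 Thm. 3.2 is a tree
theorem. Chain: (L) `X3Branch.chiBranchLowerDivisibilityAt_of_facts`; (GZ)
`branchPAdicGrossZagierAt_of_twisted` at the fact's datum; (S) §0; lower half
`cycLowerBoundAt_of_chiBranchLower_of_branchPAdicGrossZagier` + `missingLowerBoundAt_of_cycLowerBound`;
upper half `ClassX3Gord.missingUpperBoundAt_rankOne_of_wuthrichHalf_of_schneider_of_branchPAdicGrossZagier`;
glue `missingPPartAt_of_lower_of_upper`. The ONE non-published input is `hFact` (PROOF-gz Thm. 1,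
REF-gz PASS with GZ-H). Nothing booked. [cite: Delbourgo2002, Theorem (A), (B) (p. 40)]
[cite: GreenbergVatsal2000, §2 (11), (16), §3 Thm. (3.12) p. 45] [cite: Wuthrich2014, Thm. 16 (p. 397)]
[cite: GreenbergLNM1716, Props. 2.2, 2.4, 4.14] [cite: Pal2012, Thm. 3.2] [cite: Miller2011LMS, Def. 1.1] -/
theorem ClassX3Gord.bsdp_rankOne_of_facts_of_delbourgoDatumFact_of_branchCoeffOneNeZero
    (hW16 : Wuthrich2014.thm16_halfEigenCharIdeal_dvd_cyclotomicPrime)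
    (hGV : thm312_branch_unitContent_and_lambda_eq_residual_goodOrd)
    (h23 : datumSelmer_nonPrimitive_invariants)
    (h414 : Greenberg1999.prop414_noFiniteSubmodule_of_not_dvd_torsionOrder)
    (hGrK : Greenberg1999.imKummer_ge_strictCondition_goodOrdinary)
    (hLiftF : residualEpsilon_surjOn_of_lineRamifiedEven)
    (hFact : delbourgoDatum_rankOne_leadingTerms) (hDel : Delbourgo2002.mainTheorem)
    (hmod : hasEntireLFunction_rat) (hmodD : nonempty_modularParametrizationData)
    (hGZK : rank_eq_analyticRank_of_analyticRank_le_one)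
    (hX : ClassX3Gord W p) (he : semistabilityIndex W p = 2) (hp4 : p % 4 = 1) (hcm : ¬ W.HasCM)
    (hna : ReductionNonAnomalous W p) (hr : W.analyticRank = 1)
    (Φ₀ : AddSubgroup (W.geomTorsion (p : ℤ))) (hΦ : IsRationalLine W p Φ₀)
    (hram0 : ¬ LineUnramifiedAt W p Φ₀) (heven : LineEven W p Φ₀)
    (hram : ∀ (K : Type) [Field K] [NumberField K] [(galRange (K := ℚ) K).Normal],
      Module.finrank ℚ K = 2 → (∃ θ : K, θ ^ 2 = algebraMap ℚ K ((-1) ^ (p / 2) * p)) →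
      ¬ ∀ v : HeightOneSpectrum (𝓞 ℚ), ((p : ℕ) : 𝓞 ℚ) ∈ v.asIdeal →
        ∀ 𝔓 ∈ v.primesAbove, ∀ σ ∈ 𝔓.inertia (absoluteGaloisGroup ℚ), ∀ P ∈ Φ₀,
          σ • P = (if σ ∈ galRange (K := ℚ) K then P else -P))
    (hne : BranchCoeffOneNeZeroAt W p) : BSDp W p := by
  have hp2 : p ≠ 2 := by omega
  have hp5 : 5 ≤ p := by have := hp.out.two_le; omega
  have hev : Even (p / 2) := ⟨p / 4, by omega⟩
  -- (L) from published facts + the line data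
  obtain ⟨S₀, hS₀, hS⟩ := X2.GreenbergVatsalCaseOne.exists_finset_bad_not_mem W p
  have hdiv : ChiBranchLowerDivisibilityAt W p :=
    X3Branch.chiBranchLowerDivisibilityAt_of_facts hW16 hGV h23 h414 hGrK hLiftF S₀ hS₀ hS Φ₀ hΦ hram0
      heven hram
  -- the fact's datum: (B) + (GZ)
  obtain ⟨Dh, hB, hTw⟩ := hFact W p hp2 hcm hX.addv hr (Or.inl ⟨hp5, hX.typeGOrd⟩)
  have hGZ : BranchPAdicGrossZagierAt W p Dh := branchPAdicGrossZagierAt_of_twisted hGZK hr hTw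
  -- the twist model and (S)
  obtain ⟨V, iV, iVm, C, hV, hC⟩ := hX.exists_goodOrd_pStar_twist_model W p hp2 he
  have hS : SchneiderConjecture Dh :=
    schneiderConjecture_of_twisted_of_branchCoeffOneNeZero hp2 hmodD hr hTw hne V C hC hV
  -- lower half at the datum
  haveI : NeZero (V.conductorNorm ℤ) := ⟨(V.conductorNorm_pos_holds).ne'⟩
  obtain ⟨Dm⟩ := hmodD V
  obtain ⟨ϖ, -, hϖ, -⟩ := Dm.exists_rat_mul_realPeriodRat_eq_plusPeriod
  have hps : ((-1 : ℚ) ^ (p / 2) * (p : ℚ)) = (p : ℚ) := by rw [hev.neg_one_pow, one_mul]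
  have hVW : ∃ C : VariableChange ℚ, C • V.quadraticTwist (p : ℚ) = W := ⟨C, by rw [← hps]; exact hC⟩
  have hlow : CycLowerBoundAt W p Dh :=
    cycLowerBoundAt_of_chiBranchLower_of_branchPAdicGrossZagier W p
      Pal2012.thm32_sqrt_mul_realPeriodRat_twist_eq_of_prime_one_mod_four_holds hmod hGZK hX.addv hr hp4
      V hVW hV Dm.isNewformOf ϖ hϖ hdiv hGZ
  have hl : MissingLowerBoundAt W p :=
    missingLowerBoundAt_of_cycLowerBound W p hB hS
      (fun κ γ hκ hγ D ↦ hDel.isTorsion hp5 hcm hX.addv hX.typeGOrd hκ hγ D) hGZK (by rw [hr]) hna hlow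
  -- upper half at the datum, and the glue
  have hu : MissingUpperBoundAt W p :=
    hX.missingUpperBoundAt_rankOne_of_wuthrichHalf_of_schneider_of_branchPAdicGrossZagier hW16 hGZK hmod
      hmodD he hp4 hr hB hS hGZ
  exact bsdp_of_missingPPartAt W p hGZK (by rw [hr]) (missingPPartAt_of_lower_of_upper W p hl hu)

/-- **X3♯(G-ord) ∩ `I₀*`, `p ≡ 3 (mod 4)`, `p ≥ 7`, `E` non-CM, `r_an(E) = 1`, non-anomalous,
branch-parity line position: `BSD(E,p)` from PUBLISHED named facts + `hFact` + `BranchCoeffOneNeZeroAt W p`**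
— the odd-branch twin of the previous theorem: (L) §1; (GZ) `branchPAdicGrossZagierOddAt_of_twisted`;
(S) §0; lower half `cycLowerBoundAt_of_chiBranchLowerOdd_of_branchPAdicGrossZagierOdd` +
`missingLowerBoundAt_of_cycLowerBound`; upper half
`ClassX3Gord.missingUpperBoundAt_rankOne_of_wuthrichHalf_of_branchPAdicGrossZagierOdd`. Nothing booked.
[cite: Delbourgo2002, Theorem (A), (B) (p. 40)] [cite: GreenbergVatsal2000, §2 (11), (16), §3 Thm. (3.12) p. 45]
[cite: Wuthrich2014, Thm. 16 (p. 397)] [cite: GreenbergLNM1716, Props. 2.2, 2.4, 4.14] [cite: Miller2011LMS, Def. 1.1] -/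
theorem ClassX3Gord.bsdp_rankOne_of_facts_of_delbourgoDatumFact_of_branchCoeffOneNeZeroOdd
    (hW16 : Wuthrich2014.thm16_halfEigenCharIdeal_dvd_cyclotomicPrime)
    (hGV : thm312_branch_unitContent_and_lambda_eq_residual_goodOrd)
    (h23 : datumSelmer_nonPrimitive_invariants)
    (h414 : Greenberg1999.prop414_noFiniteSubmodule_of_not_dvd_torsionOrder)
    (hGrK : Greenberg1999.imKummer_ge_strictCondition_goodOrdinary)
    (hLiftF : residualEpsilon_surjOn_of_lineRamifiedEven)
    (hFact : delbourgoDatum_rankOne_leadingTerms) (hDel : Delbourgo2002.mainTheorem)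
    (hmod : hasEntireLFunction_rat) (hmodD : nonempty_modularParametrizationData)
    (hGZK : rank_eq_analyticRank_of_analyticRank_le_one)
    (hX : ClassX3Gord W p) (he : semistabilityIndex W p = 2) (hp4 : p % 4 = 3) (hp5 : 5 ≤ p)
    (hcm : ¬ W.HasCM) (hna : ReductionNonAnomalous W p) (hr : W.analyticRank = 1)
    (Φ₀ : AddSubgroup (W.geomTorsion (p : ℤ))) (hΦ : IsRationalLine W p Φ₀)
    (hram0 : ¬ LineUnramifiedAt W p Φ₀) (heven : LineEven W p Φ₀)
    (hram : ∀ (K : Type) [Field K] [NumberField K] [(galRange (K := ℚ) K).Normal],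
      Module.finrank ℚ K = 2 → (∃ θ : K, θ ^ 2 = algebraMap ℚ K ((-1) ^ (p / 2) * p)) →
      ¬ ∀ v : HeightOneSpectrum (𝓞 ℚ), ((p : ℕ) : 𝓞 ℚ) ∈ v.asIdeal →
        ∀ 𝔓 ∈ v.primesAbove, ∀ σ ∈ 𝔓.inertia (absoluteGaloisGroup ℚ), ∀ P ∈ Φ₀,
          σ • P = (if σ ∈ galRange (K := ℚ) K then P else -P))
    (hne : BranchCoeffOneNeZeroAt W p) : BSDp W p := by
  have hp2 : p ≠ 2 := by omega
  -- (L) from published facts + the line data, odd branch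
  obtain ⟨S₀, hS₀, hS⟩ := X2.GreenbergVatsalCaseOne.exists_finset_bad_not_mem W p
  have hdiv : ChiBranchLowerDivisibilityOddAt W p :=
    X3Branch.chiBranchLowerDivisibilityOddAt_of_facts hW16 hGV h23 h414 hGrK hLiftF S₀ hS₀ hS Φ₀ hΦ
      hram0 heven hram
  -- the fact's datum: (B) + (GZ)
  obtain ⟨Dh, hB, hTw⟩ := hFact W p hp2 hcm hX.addv hr (Or.inl ⟨hp5, hX.typeGOrd⟩)
  have hGZ : BranchPAdicGrossZagierOddAt W p Dh := branchPAdicGrossZagierOddAt_of_twisted hGZK hr hTw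
  -- the twist model and (S)
  obtain ⟨V, iV, iVm, C, hV, hC⟩ := hX.exists_goodOrd_pStar_twist_model W p hp2 he
  have hS : SchneiderConjecture Dh :=
    schneiderConjecture_of_twisted_of_branchCoeffOneNeZero hp2 hmodD hr hTw hne V C hC hV
  -- lower half at the datum
  haveI : NeZero (V.conductorNorm ℤ) := ⟨(V.conductorNorm_pos_holds).ne'⟩
  obtain ⟨Dm⟩ := hmodD V
  obtain ⟨ϖ, -, hϖ⟩ := exists_rat_mul_imaginaryPeriodRat_eq_minusPeriod Dm
  have hps : ((-1 : ℚ) ^ (p / 2) * (p : ℚ)) = -(p : ℚ) := by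
    rw [pStar_eq_of_mod_four p (Or.inr hp4), if_neg (by omega)]
  have hVW : ∃ C : VariableChange ℚ, C • V.quadraticTwist (-(p : ℚ)) = W :=
    ⟨C, by rw [← hps]; exact hC⟩
  have hlow : CycLowerBoundAt W p Dh :=
    cycLowerBoundAt_of_chiBranchLowerOdd_of_branchPAdicGrossZagierOdd W p hmod hGZK hX.addv hr hp4 V hVW
      hV Dm.isNewformOf ϖ hϖ hdiv hGZ
  have hl : MissingLowerBoundAt W p :=
    missingLowerBoundAt_of_cycLowerBound W p hB hS
      (fun κ γ hκ hγ D ↦ hDel.isTorsion hp5 hcm hX.addv hX.typeGOrd hκ hγ D) hGZK (by rw [hr]) hna hlow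
  -- upper half at the datum, and the glue
  have hu : MissingUpperBoundAt W p :=
    hX.missingUpperBoundAt_rankOne_of_wuthrichHalf_of_branchPAdicGrossZagierOdd hW16 hGZK hmod hmodD he
      hp4 hr hB hS hGZ
  exact bsdp_of_missingPPartAt W p hGZK (by rw [hr]) (missingPPartAt_of_lower_of_upper W p hl hu)

/-! ### §3 X4♯(G-ord) ∩ `I₀*`, rank one, `p ≡ 1 (mod 4)`: the "O7 twin" (BSTW twist clause displayed) -/

/-- **THE "O7 TWIN" (cell planner TARGET.md v2 §8, hook L1.18). X4♯(G-ord) ∩ `I₀*` (`e = 2`) ∩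
{`ρ̄_{E,p}` onto} ∩ (ram), `p ≡ 1 (mod 4)` (so `p ≥ 5`), `E` non-CM, `r_an(E) = 1`, non-anomalous:
`BSD(E,p)` GRANTED the OPEN/PRE Burungale–Skinner–Tian–Wan twist clause read Λ-adically on the
`χ_p`-branch (`hΛ`, the twist seat's §4 hook — NOT a theorem), the cell's fact `hFact`, Kato 2004
Thm. 17.4 (3) on the half eigenspace (`hK`), Delbourgo 2002 (A)+(B) (`hDel`), modularity, GZK, and ONE
analytic number `BranchCoeffOneNeZeroAt W p` (= Schneider for Delbourgo's datum, §0).** Chain: (L)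
`hΛ` on its slice `N10.CellGordTwo ∧ Irr ∧ Ram`; (GZ) `branchPAdicGrossZagierAt_of_twisted`; lower
half `cycLowerBoundAt_of_chiBranchLower_of_branchPAdicGrossZagier` + `missingLowerBoundAt_of_cycLowerBound`;
upper half `ClassX4Gord.missingUpperBoundAt_rankOne_of_katoHalf_of_schneider_of_branchPAdicGrossZagier`.
Compared with `TwistedBranchPAdicGrossZagierBSD.lean`'s per-pair pipeline, the unit certificate
`‖ϖ[T¹]B‖ = 1` is replaced by [BSTW's class-wide LOWER, PRE] + [`[T¹](ϖB) ≠ 0`]. Nothing booked.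
[claim: BurungaleSkinnerTianWan2024, status: under-review] [cite: Delbourgo2002, Theorem (A), (B) (p. 40)]
[cite: Kato2004Asterisque, Thm. 17.4 (3) (p. 273)] [cite: Pal2012, Thm. 3.2] [cite: Miller2011LMS, Def. 1.1] -/
theorem ClassX4Gord.bsdp_rankOne_of_BSTW921c_OPEN_of_delbourgoDatumFact_of_katoHalf
    (hΛ : BurungaleSkinnerTianWan2024_thm921c_twist_chiBranchLowerDivisibility_OPEN)
    (hFact : delbourgoDatum_rankOne_leadingTerms) (hDel : Delbourgo2002.mainTheorem)
    (hK : Wuthrich2014.kato_halfEigenCharIdeal_dvd_cyclotomicPrime_of_surjective)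
    (hmod : hasEntireLFunction_rat) (hmodD : nonempty_modularParametrizationData)
    (hGZK : rank_eq_analyticRank_of_analyticRank_le_one) (hX : ClassX4Gord W p)
    (he : semistabilityIndex W p = 2) (hp4 : p % 4 = 1) (hcm : ¬ W.HasCM)
    (hna : ReductionNonAnomalous W p) (hsurj : Surj W p) (hram : Ram W p) (hr : W.analyticRank = 1)
    (hne : BranchCoeffOneNeZeroAt W p) : BSDp W p := by
  have hp2 : p ≠ 2 := by omega
  have hp5 : 5 ≤ p := by have := hp.out.two_le; omega
  have hev : Even (p / 2) := ⟨p / 4, by omega⟩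
  -- (L) on BSTW's slice
  have hdiv : ChiBranchLowerDivisibilityAt W p :=
    hΛ W p hp5 hp4 ⟨hp2, hX.addv.2, hX.typeGOrd, he⟩ hX.1.2.2 hram
  -- the fact's datum: (B) + (GZ)
  obtain ⟨Dh, hB, hTw⟩ := hFact W p hp2 hcm hX.addv.2 hr (Or.inl ⟨hp5, hX.typeGOrd⟩)
  have hGZ : BranchPAdicGrossZagierAt W p Dh := branchPAdicGrossZagierAt_of_twisted hGZK hr hTw
  -- the twist model and (S)
  obtain ⟨V, iV, iVm, C, hV, hC⟩ := hX.exists_goodOrd_pStar_twist_model W p he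
  have hS : SchneiderConjecture Dh :=
    schneiderConjecture_of_twisted_of_branchCoeffOneNeZero hp2 hmodD hr hTw hne V C hC hV
  -- lower half at the datum
  haveI : NeZero (V.conductorNorm ℤ) := ⟨(V.conductorNorm_pos_holds).ne'⟩
  obtain ⟨Dm⟩ := hmodD V
  obtain ⟨ϖ, -, hϖ, -⟩ := Dm.exists_rat_mul_realPeriodRat_eq_plusPeriod
  have hps : ((-1 : ℚ) ^ (p / 2) * (p : ℚ)) = (p : ℚ) := by rw [hev.neg_one_pow, one_mul]
  have hVW : ∃ C : VariableChange ℚ, C • V.quadraticTwist (p : ℚ) = W := ⟨C, by rw [← hps]; exact hC⟩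
  have hlow : CycLowerBoundAt W p Dh :=
    cycLowerBoundAt_of_chiBranchLower_of_branchPAdicGrossZagier W p
      Pal2012.thm32_sqrt_mul_realPeriodRat_twist_eq_of_prime_one_mod_four_holds hmod hGZK hX.addv.2 hr
      hp4 V hVW hV Dm.isNewformOf ϖ hϖ hdiv hGZ
  have hl : MissingLowerBoundAt W p :=
    missingLowerBoundAt_of_cycLowerBound W p hB hS
      (fun κ γ hκ hγ D ↦ hDel.isTorsion hp5 hcm hX.addv.2 hX.typeGOrd hκ hγ D) hGZK (by rw [hr]) hna
      hlow
  -- upper half at the datum, and the glue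
  have hu : MissingUpperBoundAt W p :=
    hX.missingUpperBoundAt_rankOne_of_katoHalf_of_schneider_of_branchPAdicGrossZagier hK hGZK hmod hmodD
      he hp4 hsurj hr hB hS hGZ
  exact bsdp_of_missingPPartAt W p hGZK (by rw [hr]) (missingPPartAt_of_lower_of_upper W p hl hu)

end Summit.BirchSwinnertonDyer.Rank1Residual.Additive

end
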